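import Literature.NumberTheory.LFunctions.LandauDirichletSeries
import Mathlib.Analysis.Complex.RemovableSingularity
import HarnessLib

/-!
# A pole dichotomy from Landau's theorem: `s (s - 1) · κ · G · L = F` entire forces a simple pole of `L`

Topic `NumberTheory/LFunctions`; namespace `Literature.NumberTheory.LFunctions.Landau` (the grouping
namespace of `LandauDirichletSeries`). Theorems only.

The setting is that of an Euler product `L(s) = exp (∑ a_n n^{-s})` with NON-NEGATIVE coefficients
`a_n ≥ 0` (e.g. `L_S(s, π × π̄)`, Jacquet–Shalika (1981), proof of Thm. (5.3), p. 556, (1)–(4)),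
holomorphic on `re s > 1`, about which a global integral representation gives an identity

  `F(s) = s (s - 1) · κ · G(s) · L(s)`   on the strip `1 < re s < 2`,

with `F` ENTIRE (the continued global integral times `s (s - 1)`), `κ ≠ 0` a constant and `G` a local
factor with an entire (or at least holomorphic on `re s > 0`) reciprocal `E`, `E G = 1` for
`1 ≤ re s < 2` (a product of Gamma factors `c^s ∏ Γ_ℝ(s + a_j) ∏ Γ_ℂ(s + b_j)`, `re a_j, re b_j > -1`).
Then (`exists_ne_zero_tendsto_sub_one_mul_of_entire_eq`):

* either `F(1) ≠ 0`, and `(s - 1) L(s) → F(1) E(1) / κ ≠ 0` as `s → 1`, `re s > 1`;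
* or `F(1) = 0`, and then `L = F E / (s (s - 1) κ)` continues holomorphically to `re s > 0`, so that
  by LANDAU'S THEOREM in the exponential form of the tree
  (`Literature.NumberTheory.LFunctions.Landau.abscissaOfAbsConv_le_of_exp_eq`; Montgomery–Vaughan
  (2007), Thm. 1.7) the series `∑ a_n n^{-σ}` converges for every `σ > 0` — which is EXCLUDED as soon
  as the series is known to diverge at one real point `σ₀ > 0`.

Hence, granted the divergence at some `σ₀ > 0`, the limit `lim_{s → 1, re s > 1} (s - 1) L(s)`
exists and is non-zero: the residue-vanishing branch is impossible. This is the device by which the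
non-vanishing of a residue pairing is replaced by the positivity of the Dirichlet coefficients in the
tree's proof of Arthur–Clozel's (2.3) from an exact archimedean Rankin–Selberg datum.

## References

* H. L. Montgomery, R. C. Vaughan, *Multiplicative Number Theory I*, CUP 2007, §1.2, Thm. 1.7
  (Landau's theorem) [MontgomeryVaughan2007].
* H. Jacquet, J. A. Shalika, *On Euler products and the classification of automorphic
  representations I*, Amer. J. Math. 103 (1981), proof of Thm. (5.3), p. 556 [JacquetShalikaAJM1981].
-/

noncomputable section

open Complex LSeries Filter Topology Metric Set
open scoped ComplexOrder

namespace Literature.NumberTheory.LFunctions.Landau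

/-- The points of the strip `1 < re s < 2` form a neighbourhood of `1` within `re s > 1`. [folklore] -/
theorem eventually_nhdsWithin_one_mem_strip :
    ∀ᶠ s : ℂ in 𝓝[{s : ℂ | 1 < s.re}] 1, 1 < s.re ∧ s.re < 2 := by
  have h2 : ∀ᶠ s : ℂ in 𝓝 (1 : ℂ), s.re < 2 := by
    have : IsOpen {s : ℂ | s.re < 2} := isOpen_lt continuous_re continuous_const
    exact this.mem_nhds (by show (1 : ℂ).re < 2; norm_num)
  filter_upwards [self_mem_nhdsWithin, mem_nhdsWithin_of_mem_nhds h2] with s hs hs2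
  exact ⟨hs, hs2⟩

/-- **The pole dichotomy.** Let `a ≥ 0` with `∑ a_n n^{-s}` absolutely convergent on `re s > x₀` but
NOT at some real `σ₀ > 0`; let `L` be holomorphic on `re s > 1` with `L = exp (∑ a_n n^{-s})` for
`re s > x₀`; let `F` be entire, `κ ≠ 0`, and `E` holomorphic on `re s > 0` with `E G = 1` for
`1 ≤ re s < 2`. If `F(s) = s (s - 1) κ G(s) L(s)` on the strip `1 < re s < 2`, then
`(s - 1) L(s)` has a finite NON-ZERO limit as `s → 1`, `re s > 1` (namely `F(1) E(1) / κ`): the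
alternative `F(1) = 0` would continue `L` holomorphically to `re s > 0` and contradict Landau's
theorem (`abscissaOfAbsConv_le_of_exp_eq`) at `σ₀`. [cite: MontgomeryVaughan2007, §1.2, Thm. 1.7] -/
theorem exists_ne_zero_tendsto_sub_one_mul_of_entire_eq {a : ℕ → ℂ} (ha : 0 ≤ a) {x₀ σ₀ : ℝ}
    (hax : abscissaOfAbsConv a ≤ x₀) (hσ₀ : 0 < σ₀) (hdiv : ¬ LSeriesSummable a σ₀)
    {L : ℂ → ℂ} (hL : DifferentiableOn ℂ L {s : ℂ | 1 < s.re})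
    (hLexp : ∀ s : ℂ, x₀ < s.re → L s = Complex.exp (LSeries a s))
    {F : ℂ → ℂ} (hF : Differentiable ℂ F) {κ : ℂ} (hκ : κ ≠ 0)
    {G E : ℂ → ℂ} (hE : DifferentiableOn ℂ E {s : ℂ | 0 < s.re})
    (hEG : ∀ s : ℂ, 1 ≤ s.re → s.re < 2 → E s * G s = 1)
    (hFeq : ∀ s : ℂ, 1 < s.re → s.re < 2 → F s = s * (s - 1) * κ * G s * L s) :
    ∃ c : ℂ, c ≠ 0 ∧ Tendsto (fun s => (s - 1) * L s) (𝓝[{s : ℂ | 1 < s.re}] 1) (𝓝 c) := by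
  have hU0 : IsOpen {s : ℂ | 0 < s.re} := isOpen_lt continuous_const continuous_re
  have hE1 : E 1 ≠ 0 := by
    intro h0
    have := hEG 1 (by norm_num) (by norm_num)
    rw [h0, zero_mul] at this
    exact zero_ne_one this
  -- on the strip: `(s - 1) L s = F s * E s / (s * κ)`
  have hstrip : ∀ s : ℂ, 1 < s.re → s.re < 2 → (s - 1) * L s = F s * E s / (s * κ) := by
    intro s hs1 hs2
    have hs0 : s ≠ 0 := fun h => by rw [h, zero_re] at hs1; exact absurd hs1 (by norm_num)
    have hEGs := hEG s hs1.le hs2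
    rw [hFeq s hs1 hs2, eq_div_iff (mul_ne_zero hs0 hκ)]
    calc (s - 1) * L s * (s * κ) = s * (s - 1) * κ * (E s * G s) * L s := by rw [hEGs]; ring
      _ = s * (s - 1) * κ * G s * L s * E s := by ring
  -- continuity of `F E / (s κ)` at `1`
  have hEc : ContinuousAt E 1 :=
    (hE.differentiableAt (hU0.mem_nhds (by show (0 : ℝ) < (1 : ℂ).re; norm_num))).continuousAt
  have hQ : ContinuousAt (fun s : ℂ => F s * E s / (s * κ)) 1 :=
    (hF.continuous.continuousAt.mul hEc).div (continuousAt_id.mul continuousAt_const)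
      (mul_ne_zero one_ne_zero hκ)
  have hlim : Tendsto (fun s => (s - 1) * L s) (𝓝[{s : ℂ | 1 < s.re}] 1) (𝓝 (F 1 * E 1 / (1 * κ))) := by
    refine (hQ.tendsto.mono_left nhdsWithin_le_nhds).congr' ?_
    filter_upwards [eventually_nhdsWithin_one_mem_strip] with s hs
    exact (hstrip s hs.1 hs.2).symm
  by_cases hF1 : F 1 ≠ 0
  · exact ⟨_, div_ne_zero (mul_ne_zero hF1 hE1) (by rwa [one_mul]), hlim⟩
  -- the branch `F 1 = 0` is impossible
  exfalso
  rw [not_not] at hF1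
  -- `H = dslope F 1 · E / (s κ)` continues `L` to `re s > 0`
  set H : ℂ → ℂ := fun s => dslope F 1 s * E s / (s * κ) with hH
  have hdF : Differentiable ℂ (dslope F 1) :=
    differentiableOn_univ.1 ((Complex.differentiableOn_dslope (univ_mem)).2 hF.differentiableOn)
  have hHd : DifferentiableOn ℂ H {s : ℂ | 0 < s.re} := by
    intro s hs
    have hs0 : s ≠ 0 := fun h => by rw [h] at hs; exact absurd hs (by simp)
    exact ((hdF s).differentiableWithinAt.mul (hE s hs)).div
      (differentiableWithinAt_id.mul (differentiableWithinAt_const _)) (mul_ne_zero hs0 hκ)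
  have hHL : ∀ s : ℂ, 1 < s.re → s.re < 2 → H s = L s := by
    intro s hs1 hs2
    have hs0 : s ≠ 0 := fun h => by rw [h, zero_re] at hs1; exact absurd hs1 (by norm_num)
    have hs1' : s ≠ 1 := fun h => by rw [h, one_re] at hs1; exact lt_irrefl _ hs1
    have hsl : dslope F 1 s = (s - 1)⁻¹ * F s := by
      rw [dslope_of_ne _ hs1', slope_def_field, hF1, sub_zero, div_eq_inv_mul]
    have hmain := hstrip s hs1 hs2
    rw [hH]
    dsimp only
    rw [hsl, mul_assoc, mul_div_assoc, ← hmain, ← mul_assoc, inv_mul_cancel₀ (sub_ne_zero.2 hs1'),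
      one_mul]
  -- identity theorem: `H = L` on `re s > 1`
  have hHL' : ∀ s : ℂ, 1 < s.re → H s = L s := by
    have hUo : IsOpen {s : ℂ | 1 < s.re} := isOpen_lt continuous_const continuous_re
    have hVo : IsOpen {s : ℂ | 1 < s.re ∧ s.re < 2} :=
      (isOpen_lt continuous_const continuous_re).inter (isOpen_lt continuous_re continuous_const)
    have hz : ((3 / 2 : ℝ) : ℂ) ∈ {s : ℂ | 1 < s.re} := by
      show 1 < ((3 / 2 : ℝ) : ℂ).re
      rw [ofReal_re]; norm_num
    have hHd1 : DifferentiableOn ℂ H {s : ℂ | 1 < s.re} :=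
      hHd.mono fun s (hs : 1 < s.re) => show 0 < s.re by linarith
    have heq : EqOn H L {s : ℂ | 1 < s.re} := by
      refine (hHd1.analyticOnNhd hUo).eqOn_of_preconnected_of_eventuallyEq (hL.analyticOnNhd hUo)
        (convex_halfSpace_re_gt 1).isPreconnected hz ?_
      refine Filter.eventually_of_mem (hVo.mem_nhds ?_) fun s hs => hHL s hs.1 hs.2
      show 1 < ((3 / 2 : ℝ) : ℂ).re ∧ ((3 / 2 : ℝ) : ℂ).re < 2
      rw [ofReal_re]; norm_num
    exact fun s hs => heq hs
  -- Landau: the series converges on `re s > 0`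
  have hx₁ : abscissaOfAbsConv a ≤ max x₀ 1 := hax.trans (by exact_mod_cast le_max_left x₀ 1)
  have hle : abscissaOfAbsConv a ≤ (0 : ℝ) := by
    refine abscissaOfAbsConv_le_of_exp_eq ha hx₁ hHd fun s hs => ?_
    have hs1 : 1 < s.re := lt_of_le_of_lt (le_max_right x₀ 1) hs
    have hs0 : x₀ < s.re := lt_of_le_of_lt (le_max_left x₀ 1) hs
    rw [hHL' s hs1, hLexp s hs0]
  refine hdiv (LSeriesSummable_of_abscissaOfAbsConv_lt_re ?_)
  rw [ofReal_re]
  exact lt_of_le_of_lt hle (by exact_mod_cast hσ₀)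

end Literature.NumberTheory.LFunctions.Landau
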